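import Literature.NumberTheory.Rogawski1990.EndoscopicTorusRankTwo      -- ★ `torusMatrix`, `conjTranspose_torusMatrix_mul`, `torusMatrix_mul`, `torusMatrix_one`
import Literature.NumberTheory.Rogawski1990.StableClassesSplitTorus      -- ★ `sub_one_mul_frameGram_apply_eq_zero` (zero pattern of the frame Gram matrix)
import Literature.LinearAlgebra.Matrix.Diagonalization                    -- ★ `exists_conj_eq_diagonal_of_nodup_roots'` (Horn–Johnson Thm 1.3.9)
import Mathlib.Analysis.Complex.Basic
import Mathlib.Topology.Instances.Matrix
import Mathlib.Topology.Algebra.Constructions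
import HarnessLib

/-!
# Regular semisimple elements of `U(1,1) = U(Φ₂)(ℂ)` with bounded eigenvalues are `GL₂(ℂ)`-conjugate into ONE compact subset of `U(Φ₂)(ℂ)`
(the two Cartan subgroups of `U(1,1)`: Rogawski 1990 §3.6 p. 31; Knapp 1986 Ch. V §3; the «bounded modulo `Z₁(ℝ)`» clause of Shelstad 2012, Cor. 2.2)

Topic `NumberTheory/Rogawski1990`; namespace `Literature.NumberTheory.Rogawski1990`.  THEOREMS ONLY (no definition, no instance, no notation,
no axiom, no named fact, no `sorry`).  Cell `pub/hodgecm-mathlib`, F0∕P3c line LH3 (crux H413 = `stmt-HodgeConjecture-24833`, closer stub `stub_N9`, organ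
O2 `stub_N9transferSideBounded` of the pay-down skeleton `StubN9.paydown.skeleton.v1`): the complex-linear-algebra ENGINE of the sub-lemma (EIG→CPT)
«a `G`-regular `γ_H ∈ H_∞` whose norm partners meet a compact set is stably conjugate into a compact subset of `H_∞`» (sequel file
`ArchEndoscopicEigenvalueCompact`).

THE MATHEMATICS.  `Φ₂ = antidiag(1, 1)`, `U(Φ₂)(ℂ) = {g ∈ GL₂(ℂ) ∣ ḡᵀ Φ₂ g = Φ₂} ≅ U(1,1)`.  Let `g ∈ U(Φ₂)(ℂ)` be regular semisimple (separable
characteristic polynomial) with both eigenvalues of absolute value `≤ R`.  Diagonalise `g = S · diag(d₀, d₁) · S⁻¹` in `GL₂(ℂ)` (★ Horn–Johnson 1.3.9).  The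
Gram matrix `Q = S̄ᵀ Φ₂ S` of the (invertible, indefinite) form in the eigenframe satisfies `(d̄ᵢ dⱼ − 1) Qᵢⱼ = 0` (★ `sub_one_mul_frameGram_apply_eq_zero`), and
`det Q ≠ 0`.  Hence EITHER `d̄₀ d₁ = 1` — the SPLIT Cartan `T_s`: `diag(d₀, d₁) = diag(d₀, d̄₀⁻¹)` itself lies in `U(Φ₂)(ℂ)`, and `|d₀| · |d₁| = 1` with `|dᵢ| ≤ R`
forces `R⁻¹ ≤ |dᵢ| ≤ R` — OR `Q` is diagonal, so `Q₀₀ Q₁₁ ≠ 0` and `|d₀| = |d₁| = 1` — the COMPACT Cartan `T_c`: `g` is conjugate to the rotation-like matrix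
`½ (d₀+d₁, d₀−d₁; d₀−d₁, d₀+d₁) = P diag(d₀, d₁) P⁻¹ ∈ U(Φ₂)(ℂ)` (★ `torusMatrix`, ★ `conjTranspose_torusMatrix_mul`).  In both cases the representative and its
inverse have all entries of absolute value `≤ max R 1`, and the set of such elements of the closed subgroup `U(Φ₂)(ℂ)` is compact (closed and entrywise bounded
together with the inverses, under the closed embedding `GL₂ ↪ M₂ × M₂ᵐᵒᵖ`).  An UPPER bound on the eigenvalues suffices: unitarity pairs `λ ↔ λ̄⁻¹`.

* §1 `isCompact_setOf_norm_apply_le_and_inv` — `{g ∈ GL_N(ℂ) ∣ |gᵢⱼ| ≤ B, |(g⁻¹)ᵢⱼ| ≤ B}` is compact (any `N`).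
* §2 `norm_torusMatrix_apply_le_one` — entries of `torusMatrix d₀ d₁` for `|dᵢ| = 1` have absolute value `≤ 1`.
* §3 **`exists_isCompact_forall_isConj_of_mem_unitaryGroupOfForm_antidiag_two`** — the engine: for every `R` ONE compact `C ⊆ U(Φ₂)(ℂ)` receives, up to
  `GL₂(ℂ)`-conjugacy (= stable conjugacy), every regular semisimple `g ∈ U(Φ₂)(ℂ)` whose eigenvalues have absolute value `≤ R`.
NOT HERE: the number-field dress (`H_∞ = U(Φ₂)(L⁺ ⊗ ℝ) × U(Φ₁)(L⁺ ⊗ ℝ)`, place by place) — see `ArchEndoscopicEigenvalueCompact`.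
HONEST LABEL: HC_CM is proved only modulo the 7 printed citations (2 remaining: hLiu418, h413) until rung 0 closes; this file is linear algebra and pays
nothing by itself.

## References
* [Rogawski1990] J. D. Rogawski, *Automorphic Representations of Unitary Groups in Three Variables*, Ann. of Math. Stud. 123 (1990), §3.1 p. 19 (stable
  conjugacy = `GL_n`-conjugacy), §3.6 p. 31 (the Cartan subgroups of `U(2)`, `U(1,1)`: types (0) and (1)).
* [Knapp1986] A. W. Knapp, *Representation Theory of Semisimple Groups*, PMS 36 (1986), Ch. V §3 (Cartan subgroups of `SU(1,1)`, `SL(2, ℝ)`).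
* [Shelstad2012] D. Shelstad, *On geometric transfer in real twisted endoscopy*, Ann. of Math. 176 (2012), Cor. 2.2 p. 1926 («vanish off the conjugacy classes
  meeting a set … bounded modulo `Z₁(ℝ)`»).
* [HornJohnson2013] R. A. Horn, C. R. Johnson, *Matrix Analysis*, 2nd ed. (2013), Thm 1.3.9 (distinct eigenvalues ⇒ diagonalisable).
-/

set_option autoImplicit false

noncomputable section

open Matrix Topology Polynomial
open Literature.NumberTheory.Automorphic (unitaryGroupOfForm mem_unitaryGroupOfForm_iff)
open scoped MatrixGroups ComplexConjugate

namespace Literature.NumberTheory.Rogawski1990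

/-! ## §1 Entrywise bounded pieces of `GL_N(ℂ)` are compact -/

section EntryBounds

variable (N : ℕ)

/-- **`{g ∈ GL_N(ℂ) ∣ |gᵢⱼ| ≤ B and |(g⁻¹)ᵢⱼ| ≤ B for all i, j}` is compact**: under the embedding `GL_N ↪ M_N × M_Nᵐᵒᵖ`, `g ↦ (g, g⁻¹)`
(Mathlib `Units.isEmbedding_embedProduct`) it is the closed subset `{(a, b) ∣ a b = b a = 1}` of the compact box `{|aᵢⱼ| ≤ B} × {|bᵢⱼ| ≤ B}`.
[folklore] [cite: PlatonovRapinchuk1994, §3.2 Thm 3.1] -/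
theorem isCompact_setOf_norm_apply_le_and_inv (B : ℝ) :
    IsCompact {g : GL (Fin N) ℂ | ∀ i j, ‖(g : Matrix (Fin N) (Fin N) ℂ) i j‖ ≤ B ∧ ‖((g⁻¹ : GL (Fin N) ℂ) : Matrix (Fin N) (Fin N) ℂ) i j‖ ≤ B} := by
  classical
  set box : Set (Matrix (Fin N) (Fin N) ℂ) := {M | ∀ i j, M i j ∈ Metric.closedBall (0 : ℂ) B} with hboxdef
  have hbox : IsCompact box := by
    have hb : box = Set.univ.pi fun _ : Fin N => Set.univ.pi fun _ : Fin N => Metric.closedBall (0 : ℂ) B :=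
      Set.ext fun M => ⟨fun h i _ j _ => h i j, fun h i j => h i (Set.mem_univ _) j (Set.mem_univ _)⟩
    rw [hb]
    exact isCompact_univ_pi fun _ => isCompact_univ_pi fun _ => isCompact_closedBall _ _
  have hboxc : IsClosed box := hbox.isClosed
  set T : Set (Matrix (Fin N) (Fin N) ℂ × (Matrix (Fin N) (Fin N) ℂ)ᵐᵒᵖ) :=
    {p | p.1 ∈ box ∧ p.2.unop ∈ box ∧ p.1 * p.2.unop = 1 ∧ p.2.unop * p.1 = 1} with hTdef
  have h1 : Continuous fun p : Matrix (Fin N) (Fin N) ℂ × (Matrix (Fin N) (Fin N) ℂ)ᵐᵒᵖ => p.1 := continuous_fst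
  have h2 : Continuous fun p : Matrix (Fin N) (Fin N) ℂ × (Matrix (Fin N) (Fin N) ℂ)ᵐᵒᵖ => p.2.unop :=
    MulOpposite.continuous_unop.comp continuous_snd
  have hTclosed : IsClosed T :=
    (hboxc.preimage h1).inter ((hboxc.preimage h2).inter
      ((isClosed_eq (h1.mul h2) continuous_const).inter (isClosed_eq (h2.mul h1) continuous_const)))
  have hTsub : T ⊆ box ×ˢ (MulOpposite.op '' box) := by
    rintro ⟨a, b⟩ ⟨ha, hb, -, -⟩
    exact ⟨ha, b.unop, hb, rfl⟩
  have hTcpt : IsCompact T := (hbox.prod (hbox.image MulOpposite.continuous_op)).of_isClosed_subset hTclosed hTsub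
  have himage : Units.embedProduct (Matrix (Fin N) (Fin N) ℂ) ''
      {g : GL (Fin N) ℂ | ∀ i j, ‖(g : Matrix (Fin N) (Fin N) ℂ) i j‖ ≤ B ∧ ‖((g⁻¹ : GL (Fin N) ℂ) : Matrix (Fin N) (Fin N) ℂ) i j‖ ≤ B} = T := by
    ext p
    constructor
    · rintro ⟨g, hg, rfl⟩
      refine ⟨fun i j => ?_, fun i j => ?_, g.mul_inv, g.inv_mul⟩
      · rw [Metric.mem_closedBall, dist_zero_right]; exact (hg i j).1
      · rw [Metric.mem_closedBall, dist_zero_right]; exact (hg i j).2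
    · rintro ⟨hp1, hp2, hp3, hp4⟩
      refine ⟨⟨p.1, p.2.unop, hp3, hp4⟩, fun i j => ⟨?_, ?_⟩, Prod.ext rfl rfl⟩
      · have h := hp1 i j
        rwa [Metric.mem_closedBall, dist_zero_right] at h
      · have h := hp2 i j
        rwa [Metric.mem_closedBall, dist_zero_right] at h
  rw [Units.isEmbedding_embedProduct.isCompact_iff, himage]
  exact hTcpt

end EntryBounds

/-! ## §2 Entries of the compact-torus representative -/

section TorusEntries

/-- For `|d₀| = |d₁| = 1` every entry `(d₀ ± d₁)∕2` of ★ `torusMatrix d₀ d₁` has absolute value `≤ 1`. [cite: Rogawski1990, §4.6 Prop. 4.6.1] -/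
theorem norm_torusMatrix_apply_le_one {d₀ d₁ : ℂ} (h₀ : ‖d₀‖ = 1) (h₁ : ‖d₁‖ = 1) (i j : Fin 2) :
    ‖torusMatrix d₀ d₁ i j‖ ≤ 1 := by
  have hadd : ‖d₀ + d₁‖ / 2 ≤ 1 := by
    have := norm_add_le d₀ d₁
    rw [h₀, h₁] at this
    linarith
  have hsub : ‖d₀ - d₁‖ / 2 ≤ 1 := by
    have := norm_sub_le d₀ d₁
    rw [h₀, h₁] at this
    linarith
  fin_cases i <;> fin_cases j <;> simp [torusMatrix] <;> first | exact hadd | exact hsub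

end TorusEntries

/-! ## §3 The engine: regular semisimple elements of `U(Φ₂)(ℂ)` with bounded eigenvalues, up to `GL₂(ℂ)`-conjugacy, in ONE compact set -/

section Engine

/-- **(EIG→CPT), complex engine.**  For every `R` there is a COMPACT `C ⊆ U(Φ₂)(ℂ)` (`Φ₂ = antidiag(1,1)`, `U(Φ₂)(ℂ) ≅ U(1,1)`) such that every
regular semisimple `g ∈ U(Φ₂)(ℂ)` all of whose eigenvalues have absolute value `≤ R` is `GL₂(ℂ)`-conjugate (= stably conjugate) to an element of `C`:
`C = {δ ∈ U(Φ₂)(ℂ) ∣ |δᵢⱼ|, |(δ⁻¹)ᵢⱼ| ≤ max R 1}` receives the split-Cartan representative `diag(d₀, d̄₀⁻¹)` (`R⁻¹ ≤ |d₀| ≤ R`) or the compact-Cartan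
representative `½ (d₀+d₁, d₀−d₁; d₀−d₁, d₀+d₁)` (`|dᵢ| = 1`) of `g`, according to the zero pattern of the frame Gram matrix of `Φ₂`.
[cite: Rogawski1990, §3.6 p. 31; §3.1 p. 19] [cite: Knapp1986, Ch. V §3] [cite: Shelstad2012, Cor. 2.2 p. 1926] -/
theorem exists_isCompact_forall_isConj_of_mem_unitaryGroupOfForm_antidiag_two (R : ℝ) :
    ∃ C : Set (GL (Fin 2) ℂ), IsCompact C ∧
      C ⊆ (unitaryGroupOfForm (starRingEnd ℂ) (Matrix.of fun i j : Fin 2 => if i.val + j.val + 1 = 2 then (1 : ℂ) else 0) : Set (GL (Fin 2) ℂ)) ∧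
      ∀ g : GL (Fin 2) ℂ, g ∈ unitaryGroupOfForm (starRingEnd ℂ) (Matrix.of fun i j : Fin 2 => if i.val + j.val + 1 = 2 then (1 : ℂ) else 0) →
        (g : Matrix (Fin 2) (Fin 2) ℂ).charpoly.Separable →
        (∀ z : ℂ, (g : Matrix (Fin 2) (Fin 2) ℂ).charpoly.IsRoot z → ‖z‖ ≤ R) →
          ∃ δ ∈ C, IsConj g δ := by
  classical
  set J : Matrix (Fin 2) (Fin 2) ℂ := Matrix.of fun i j : Fin 2 => if i.val + j.val + 1 = 2 then (1 : ℂ) else 0 with hJ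
  have hJ00 : J 0 0 = 0 := rfl
  have hJ01 : J 0 1 = 1 := rfl
  have hJ10 : J 1 0 = 1 := rfl
  have hJ11 : J 1 1 = 0 := rfl
  have hJdet : J.det = -1 := by rw [Matrix.det_fin_two, hJ00, hJ01, hJ10, hJ11]; ring
  set B : ℝ := max R 1 with hB
  have hRB : R ≤ B := le_max_left _ _
  have h1B : (1 : ℝ) ≤ B := le_max_right _ _
  -- the closed subgroup `U(Φ₂)(ℂ)`
  have hUc : IsClosed (unitaryGroupOfForm (starRingEnd ℂ) J : Set (GL (Fin 2) ℂ)) := by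
    have h1 : Continuous fun g : GL (Fin 2) ℂ => (g : Matrix (Fin 2) (Fin 2) ℂ) := Units.continuous_val
    exact isClosed_eq (((h1.matrix_map Complex.continuous_conj).matrix_transpose.mul continuous_const).mul h1) continuous_const
  refine ⟨(unitaryGroupOfForm (starRingEnd ℂ) J : Set (GL (Fin 2) ℂ)) ∩
      {δ : GL (Fin 2) ℂ | ∀ i j, ‖(δ : Matrix (Fin 2) (Fin 2) ℂ) i j‖ ≤ B ∧ ‖((δ⁻¹ : GL (Fin 2) ℂ) : Matrix (Fin 2) (Fin 2) ℂ) i j‖ ≤ B},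
    (isCompact_setOf_norm_apply_le_and_inv 2 B).inter_left hUc, Set.inter_subset_left, ?_⟩
  intro g hg hsep hroot
  -- Step 1: diagonalise `g = S diag(d) S⁻¹` in `GL₂(ℂ)`
  obtain ⟨S, d, hS, hSD, hd⟩ :=
    Literature.LinearAlgebra.Matrix.exists_conj_eq_diagonal_of_nodup_roots' (g : Matrix (Fin 2) (Fin 2) ℂ) (Polynomial.nodup_roots hsep)
  have hdroot : ∀ i, (g : Matrix (Fin 2) (Fin 2) ℂ).charpoly.IsRoot (d i) := fun i => by
    rw [← Polynomial.mem_roots (Matrix.charpoly_monic _).ne_zero, ← hd]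
    exact Multiset.mem_map_of_mem _ (Finset.mem_univ_val i)
  have hdle : ∀ i, ‖d i‖ ≤ R := fun i => hroot _ (hdroot i)
  have hd01 : d 0 ≠ d 1 := by
    intro h
    have hnd : (Finset.univ.val.map d).Nodup := by rw [hd]; exact Polynomial.nodup_roots hsep
    have := Multiset.inj_on_of_nodup_map hnd 0 (Finset.mem_univ_val 0) 1 (Finset.mem_univ_val 1) h
    exact absurd this (by decide)
  have hgS : (g : Matrix (Fin 2) (Fin 2) ℂ) * S = S * diagonal d := by
    have h := congrArg (fun M => S * M) hSD
    simpa only [← Matrix.mul_assoc, Matrix.mul_nonsing_inv _ hS, Matrix.one_mul] using h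
  have hgJ : ((g : Matrix (Fin 2) (Fin 2) ℂ).map (starRingEnd ℂ))ᵀ * J * (g : Matrix (Fin 2) (Fin 2) ℂ) = J := hg
  -- Step 2: the frame Gram matrix `Q = S̄ᵀ Φ₂ S` and its zero pattern
  set Q : Matrix (Fin 2) (Fin 2) ℂ := (S.map (starRingEnd ℂ))ᵀ * J * S with hQ
  have hQ0 : ∀ i j, (starRingEnd ℂ (d i) * d j - 1) * Q i j = 0 := fun i j =>
    sub_one_mul_frameGram_apply_eq_zero (starRingEnd ℂ) hgJ hgS i j
  have hSdet : S.det ≠ 0 := hS.ne_zero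
  have hQdet : Q.det ≠ 0 := by
    have hm : (S.map (starRingEnd ℂ)).det = starRingEnd ℂ S.det := by
      rw [← RingHom.mapMatrix_apply, ← RingHom.map_det]
    rw [hQ, det_mul, det_mul, det_transpose, hm, hJdet]
    exact mul_ne_zero (mul_ne_zero ((_root_.map_ne_zero _).2 hSdet) (by norm_num)) hSdet
  -- the `GL₂(ℂ)`-conjugate `D = S⁻¹ g S` with matrix `diag(d)`
  set Su : GL (Fin 2) ℂ := Matrix.nonsingInvUnit S hS with hSu
  have hSu_val : ((Su : GL (Fin 2) ℂ) : Matrix (Fin 2) (Fin 2) ℂ) = S := rfl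
  have hSu_inv : ((Su⁻¹ : GL (Fin 2) ℂ) : Matrix (Fin 2) (Fin 2) ℂ) = S⁻¹ := rfl
  set D : GL (Fin 2) ℂ := Su⁻¹ * g * Su with hD
  have hDval : ((D : GL (Fin 2) ℂ) : Matrix (Fin 2) (Fin 2) ℂ) = diagonal d := by
    rw [hD, Units.val_mul, Units.val_mul, hSu_val, hSu_inv]; exact hSD
  have hgD : IsConj g D := isConj_iff.2 ⟨Su⁻¹, by rw [hD, inv_inv]⟩
  by_cases hsplit : starRingEnd ℂ (d 0) * d 1 = 1
  · /- CASE A — split Cartan: `d₁ = d̄₀⁻¹`, the diagonal matrix itself is unitary -/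
    have hsplit' : starRingEnd ℂ (d 1) * d 0 = 1 := by
      have h := congrArg (starRingEnd ℂ) hsplit
      rwa [map_mul, Complex.conj_conj, map_one, mul_comm] at h
    have hd0 : d 0 ≠ 0 := fun h => by rw [h, mul_zero] at hsplit'; exact zero_ne_one hsplit'
    have hd1 : d 1 ≠ 0 := fun h => by rw [h, mul_zero] at hsplit; exact zero_ne_one hsplit
    have hnorm : ‖d 0‖ * ‖d 1‖ = 1 := by
      have h := congrArg (fun z : ℂ => ‖z‖) hsplit
      simpa only [norm_mul, RCLike.norm_conj, norm_one] using h
    have hinv0 : ‖d 0‖⁻¹ ≤ R := by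
      rw [inv_eq_of_mul_eq_one_right hnorm]; exact hdle 1
    have hinv1 : ‖d 1‖⁻¹ ≤ R := by
      rw [mul_comm] at hnorm
      rw [inv_eq_of_mul_eq_one_right hnorm]; exact hdle 0
    -- `D ∈ U(Φ₂)(ℂ)`
    have hDmem : D ∈ unitaryGroupOfForm (starRingEnd ℂ) J := by
      rw [mem_unitaryGroupOfForm_iff, hDval, diagonal_map (map_zero _), diagonal_transpose]
      ext i j
      fin_cases i <;> fin_cases j <;>
        simp [Matrix.mul_apply, diagonal, hJ00, hJ01, hJ10, hJ11, hsplit, hsplit']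
    -- the inverse matrix of `D`
    have hDinv : ((D⁻¹ : GL (Fin 2) ℂ) : Matrix (Fin 2) (Fin 2) ℂ) = diagonal fun i => (d i)⁻¹ := by
      rw [Matrix.coe_units_inv, hDval]
      refine Matrix.inv_eq_left_inv ?_
      rw [diagonal_mul_diagonal]
      convert diagonal_one with i
      fin_cases i
      · exact inv_mul_cancel₀ hd0
      · exact inv_mul_cancel₀ hd1
    refine ⟨D, ⟨hDmem, fun i j => ⟨?_, ?_⟩⟩, hgD⟩
    · rw [hDval]
      fin_cases i <;> fin_cases j <;> simp [diagonal]
      · exact (hdle 0).trans hRB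
      · exact le_trans (by norm_num) h1B
      · exact le_trans (by norm_num) h1B
      · exact (hdle 1).trans hRB
    · rw [hDinv]
      fin_cases i <;> fin_cases j <;> simp [diagonal]
      · exact hinv0.trans hRB
      · exact le_trans (by norm_num) h1B
      · exact le_trans (by norm_num) h1B
      · exact hinv1.trans hRB
  · /- CASE B — compact Cartan: `Q` is diagonal, so `|d₀| = |d₁| = 1`; representative `torusMatrix d₀ d₁ = P diag(d) P⁻¹` -/
    have hsplit' : starRingEnd ℂ (d 1) * d 0 - 1 ≠ 0 := by
      intro h
      apply hsplit
      have h' := congrArg (starRingEnd ℂ) (sub_eq_zero.1 h)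
      rwa [map_mul, Complex.conj_conj, map_one, mul_comm] at h'
    have hQ01 : Q 0 1 = 0 := (mul_eq_zero.1 (hQ0 0 1)).resolve_left (sub_ne_zero.2 hsplit)
    have hQ10 : Q 1 0 = 0 := (mul_eq_zero.1 (hQ0 1 0)).resolve_left hsplit'
    have hQdiag : Q 0 0 * Q 1 1 ≠ 0 := by
      rw [Matrix.det_fin_two, hQ01, hQ10, mul_zero, sub_zero] at hQdet
      exact hQdet
    have hu0 : starRingEnd ℂ (d 0) * d 0 = 1 :=
      sub_eq_zero.1 ((mul_eq_zero.1 (hQ0 0 0)).resolve_right (left_ne_zero_of_mul hQdiag))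
    have hu1 : starRingEnd ℂ (d 1) * d 1 = 1 :=
      sub_eq_zero.1 ((mul_eq_zero.1 (hQ0 1 1)).resolve_right (right_ne_zero_of_mul hQdiag))
    have hn0 : ‖d 0‖ = 1 := by
      have h := congrArg (fun z : ℂ => ‖z‖) hu0
      simp only [norm_mul, RCLike.norm_conj, norm_one] at h
      rcases mul_self_eq_one_iff.1 h with h' | h'
      · exact h'
      · linarith [norm_nonneg (d 0)]
    have hn1 : ‖d 1‖ = 1 := by
      have h := congrArg (fun z : ℂ => ‖z‖) hu1
      simp only [norm_mul, RCLike.norm_conj, norm_one] at h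
      rcases mul_self_eq_one_iff.1 h with h' | h'
      · exact h'
      · linarith [norm_nonneg (d 1)]
    have hd0 : d 0 ≠ 0 := fun h => by rw [h, norm_zero] at hn0; exact zero_ne_one hn0
    have hd1 : d 1 ≠ 0 := fun h => by rw [h, norm_zero] at hn1; exact zero_ne_one hn1
    -- the representative as a unit, with inverse `torusMatrix d₀⁻¹ d₁⁻¹`
    set δ : GL (Fin 2) ℂ :=
      ⟨torusMatrix (d 0) (d 1), torusMatrix (d 0)⁻¹ (d 1)⁻¹,
        by rw [torusMatrix_mul, mul_inv_cancel₀ hd0, mul_inv_cancel₀ hd1, torusMatrix_one],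
        by rw [torusMatrix_mul, inv_mul_cancel₀ hd0, inv_mul_cancel₀ hd1, torusMatrix_one]⟩ with hδ
    have hδval : ((δ : GL (Fin 2) ℂ) : Matrix (Fin 2) (Fin 2) ℂ) = torusMatrix (d 0) (d 1) := rfl
    have hδinv : ((δ⁻¹ : GL (Fin 2) ℂ) : Matrix (Fin 2) (Fin 2) ℂ) = torusMatrix (d 0)⁻¹ (d 1)⁻¹ := rfl
    -- `δ ∈ U(Φ₂)(ℂ)`
    have hδmem : δ ∈ unitaryGroupOfForm (starRingEnd ℂ) J := by
      rw [mem_unitaryGroupOfForm_iff, hδval, hJ]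
      exact conjTranspose_torusMatrix_mul (starRingEnd ℂ) hu0 hu1
    -- `D ∼ δ` through the frame `P = (1 1; 1 −1)`
    have hPdet : (!![(1 : ℂ), 1; 1, -1] : Matrix (Fin 2) (Fin 2) ℂ).det ≠ 0 := by
      rw [Matrix.det_fin_two]; norm_num
    set Pu : GL (Fin 2) ℂ := Matrix.nonsingInvUnit (!![(1 : ℂ), 1; 1, -1]) (isUnit_iff_ne_zero.2 hPdet) with hPu
    have hPu_val : ((Pu : GL (Fin 2) ℂ) : Matrix (Fin 2) (Fin 2) ℂ) = !![(1 : ℂ), 1; 1, -1] := rfl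
    have hDδ : IsConj D δ := by
      refine isConj_iff.2 ⟨Pu, ?_⟩
      rw [mul_inv_eq_iff_eq_mul]
      apply Units.ext
      show (Pu : Matrix (Fin 2) (Fin 2) ℂ) * (D : Matrix (Fin 2) (Fin 2) ℂ) = (δ : Matrix (Fin 2) (Fin 2) ℂ) * (Pu : Matrix (Fin 2) (Fin 2) ℂ)
      rw [hPu_val, hDval, hδval]
      ext i j
      fin_cases i <;> fin_cases j <;> simp [torusMatrix, Matrix.mul_apply, Fin.sum_univ_two, diagonal] <;> ring
    refine ⟨δ, ⟨hδmem, fun i j => ⟨?_, ?_⟩⟩, hgD.trans hDδ⟩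
    · rw [hδval]; exact (norm_torusMatrix_apply_le_one hn0 hn1 i j).trans h1B
    · rw [hδinv]
      refine (norm_torusMatrix_apply_le_one ?_ ?_ i j).trans h1B
      · rw [norm_inv, hn0, inv_one]
      · rw [norm_inv, hn1, inv_one]

end Engine

end Literature.NumberTheory.Rogawski1990

end
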